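import Summits.QuantumFields.BalabanUV.T4Continuum.Support.VariationalColourUpperBound
import Summits.QuantumFields.BalabanUV.T4Continuum.Support.VariationalCovariantUpperBoundRel

/-!
# T⁴ programme, spine node NE2 (U1a), lane P2 — SUPPLIER LEAF V-COL-UB RELATIVE TO A REFERENCE TRANSPORT: the colour ∕ `E`-valued form of the road owner's
# repair (R1) «UB⁺ relative to a reference transport» — ACTUAL site transports in the constraint, a contractive REFERENCE pair in the energy, tied by
# `‖T∘S₀ − 1‖ ≤ γ < 1`; constant `Λ(n·w)·(1 − γ)⁻²`, re-packable as `Λ(n·w_eff)`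

NE2 formalisation swarm `b2b-balaban-t4-ne2-formalise-*`, leaf 03 GEN 4 (`prover-b2b-balaban-t4-ne2-formalise-leaf-03-g4-0`); file 3 of item (O8) «V-COL», member
UB⁺ (journal INTENT CLAIMS.log l.10560), the COLOUR TWIN of the road owner t4-ne2-p2-g11's scalar `Support/VariationalCovariantUpperBoundRel` (imported: its
`weights_mean_one` and `lamC_rel_le` are used BY NAME), written after his LOCATED FINDING N-ne2p2g11-2 (journal 2026-08-20T09:59:27Z) «the END's UB⁺
binder is flat-only JOINTLY with COMP⁺: nested composite transports have in-block defect Θ(α), not O(α∕n); REPAIR (R1) = UB⁺ RELATIVE TO A REFERENCE TRANSPORT: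
competitor `conj(T₀)·(β₁^d)⁻¹·ψ_{φ′}`, `φ′ z := φ z ∕ A_z`, `A_z := n^{−d}Σ T·conj T₀·(β₁^d)⁻¹·bumpW`, `‖A_z − 1‖ ≤ γ`, energy `≤ Λc(n w)∕(1−γ)²·nsq φ`,
and `Λc(n w)∕(1−γ)² ≤ Λc(n·w_eff)`, `n·w_eff := (4 + n·w)∕(1−γ) − 1`».  THIS FILE is that repair for `E`-valued fields and NON-COMMUTING transports, on
top of file 1 `Support/VariationalColourUpperBound` (the absolute colour leaf, BY NAME: `comp`, `nsqv`, `physDirv_comp_le`; carriers `Qcv`∕`dirUv` = leaf-02-g4's):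
 * §1 the BLOCK OPERATOR `A_z := n^{−d} Σ_j ((β₁^d)⁻¹·W(j)) • (T(x_j) ∘ S₀(x_j)) : E →L[ℂ] E` (`Az`; the scalar `A_z` is its `E = ℂ` instance), `A_z − 1 =
   n^{−d} Σ_j (c W_j) • (T S₀ − 1)(x_j)` (`Az_sub_one`, weights of normalised sum EXACTLY `1`: `sum_weights_eq_one`), hence **`‖A_z − 1‖ ≤ γ`** (`norm_Az_sub_one_le`);
 * §2 (`E` complete) the Neumann inverse `B_z := Σ_k (1 − A_z)^k` (`Bz`, Mathlib `Units.oneSub`): `A_z ∘ B_z = 1`, `‖B_z‖ ≤ (1 − γ)⁻¹` (`Az_mul_Bz`, via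
   `tsum_geometric_le_of_norm_lt_one` and `‖1‖ ≤ 1`), and the RELATIVE competitor `comp S₀ (z ↦ B_z(φ z))` — the reference right inverses with the block data
   PRE-ROTATED by `B_z` (the non-commutative reading of `φ z ∕ A_z`: `B_z` acts BEFORE `S₀(x)`, so `Q_T(comp S₀ φ′)(z) = A_z(φ′ z)` and the ORDER closes) — meets
   the constraint for the ACTUAL transports EXACTLY: **`Qcv_comp_rel : Qcv T (comp S₀ (B·φ)) = φ`**;
 * §3 the energy is file 1's bound for `(T₀, S₀)` at the data `B·φ`, and `Σ‖B_z φ z‖² ≤ (1−γ)⁻²Σ‖φ z‖²` (`nsqv_Bz_le`) ⟹ **`physDirv_comp_rel_le`**,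
   **`blockSpin_colour_le_rel : blockSpin (Qcv n M T) Sc φ ≤ 2d·36^d·((1 + n w)² + 9)∕(1 − γ)²·Σ‖φ‖²`**, `exists_ubv_rel` (the owner's constant, letter for letter);
 * §4 the owner's re-packing `lamC_rel_le` (`((1 + x)² + 9)∕(1 − γ)² ≤ (1 + x′)² + 9` for `(4 + x)∕(1 − γ) − 1 ≤ x′`) BY NAME ⟹ **`exists_ubv_rel_eff`** = the
   shape of file 1's `exists_ubv_phys` VERBATIM at any fictitious defect `w_eff` with `(4 + n·w)∕(1−γ) − 1 ≤ n·w_eff` (colour twin of his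
   `exists_ub_scalarPair_rel_eff`; CLASS preserved: `n·w_eff ≤ (4 + c_w)∕(1−γ) − 1`).
BINDERS DISPLAYED: `T₀∘S₀ = 1`, `‖T₀‖, ‖S₀‖, ‖R‖ ≤ 1`, the in-block defect `w` of `(R, S₀, T₀)`, `γ < 1`, `‖T(x)∘S₀(x) − 1‖ ≤ γ`; NOTHING on `T` itself (not even
`‖T‖ ≤ 1`).  For unitary colour data `S₀ = T₀⁻¹` and `‖T∘T₀⁻¹ − 1‖ = ‖T − T₀‖`.

HONEST FRAMING (T4-DAG p. 1).  Model level; transporters DATA; [folklore] (Neumann series + file 1); nothing printed is a hypothesis; two data `def`s (`Az`, `Bz`),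
no `def … : Prop`, no `sorry`; axioms standard.  NOT CLAIMED: the geometric supplier `γ ≤ C_d·n²·a` for nested-vs-straight contours (the owner's (O10), U(1)
first), the scalar (R2)–(R3) re-runs (owner); at `E = ℂ`, `T = t•1`, `S₀ = conj t₀•1` the statements here are the owner's (R1) up to `•` = `·` and `B_z` (Neumann
series) for his `1∕A_z` (cf. file 2's `carriers_complex`); the other V-COL members; the 1-form leaves.  NE2 NOT proved; spine 0/9; rung
(B)+1 finite T⁴ — NOT infinite volume, NOT mass gap, NOT Clay.  HONEST DEPENDENCY (cell, verbatim): continuum YM on T⁴ ⇐ BetaPertH ∧ nine spine estimates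
(0/9 proved); BetaPertH ⇐ (D1) ∧ (D4) ∧ CAP+tail; G-an2-4 gates asym, D1 and NE2/3/4.
-/

noncomputable section

namespace Summit.QuantumFields.BalabanUV.T4Continuum.VariationalColourUpperBound

open Finset
open scoped ComplexConjugate
open Literature.MathematicalPhysics.QuantumFieldTheory.Balaban1983to89
open Literature.MathematicalPhysics.QuantumFieldTheory.Balaban1983to89.B5Prop11Plancherel (Tor fine unitVec)
open Literature.MathematicalPhysics.QuantumFieldTheory.Balaban1983to89.B5Block118 (bpt)
open Summit.QuantumFields.BalabanUV.T4Continuum.ScalarBlockTrialFunction (beta1 beta1_ge bumpW bumpW_mem sum_bumpW_eq)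
open Summit.QuantumFields.BalabanUV.T4Continuum.VariationalTransfer (blockSpin blockSpin_le)
open Summit.QuantumFields.BalabanUV.T4Continuum.VariationalCovariantUpperBound (inv_beta_pow_mem)
open Summit.QuantumFields.BalabanUV.T4Continuum.VariationalColourFederbush (Qcv dirUv dirUv_nonneg)
open Summit.QuantumFields.BalabanUV.T4Continuum.VariationalCovariantUpperBoundRel (weights_mean_one lamC_rel_le)

variable {d : ℕ} (n : ℕ) [NeZero n] (M : Fin d → ℕ) [hM : ∀ μ, NeZero (M μ)]
variable {E : Type*} [NormedAddCommGroup E] [NormedSpace ℂ E]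

/-! ## §1 The block operator `A_z = n^{−d} Σ_j (c·W(j)) • (T(x_j) ∘ S₀(x_j))` of the actual transports against the reference -/

/-- the BLOCK OPERATOR `A_z := n^{−d} Σ_{j} ((β₁^d)⁻¹·W(j)) • (T(n·z+j) ∘ S₀(n·z+j))` — the bump-weighted block mean of the relative transports `T∘S₀`
(`= 1` when `T = T₀`, since the weights have mean exactly `β₁^d`). [folklore] -/
def Az (T S₀ : Tor (fine n M) → (E →L[ℂ] E)) (z : Tor M) : E →L[ℂ] E :=
  (((n : ℂ) ^ d)⁻¹ : ℂ) • ∑ j : Fin d → Fin n, (((((beta1 n) ^ d)⁻¹ * bumpW n j : ℝ)) : ℂ) • (T (bpt n M z j) * S₀ (bpt n M z j))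

/-- the normalised weights sum to one, `n^{−d} Σ_j (β₁^d)⁻¹·W(j) = 1` — complex form of the road owner's `weights_mean_one`. [folklore] -/
theorem sum_weights_eq_one :
    (((n : ℂ) ^ d)⁻¹ : ℂ) * ∑ j : Fin d → Fin n, (((((beta1 n) ^ d)⁻¹ * bumpW n j : ℝ)) : ℂ) = 1 := by
  have hβc : ((beta1 n : ℝ) : ℂ) ≠ 0 := by exact_mod_cast (beta1_ge n).2.ne'
  have hn : (n : ℂ) ≠ 0 := by exact_mod_cast NeZero.ne n
  push_cast
  rw [← Finset.mul_sum, ← Complex.ofReal_sum, sum_bumpW_eq n]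
  push_cast
  rw [mul_pow]
  field_simp

omit [NeZero n] hM in
/-- `A_z` applied to a vector. [folklore] -/
theorem Az_apply (T S₀ : Tor (fine n M) → (E →L[ℂ] E)) (z : Tor M) (v : E) :
    Az n M T S₀ z v = (((n : ℂ) ^ d)⁻¹ : ℂ) • ∑ j : Fin d → Fin n, (((((beta1 n) ^ d)⁻¹ * bumpW n j : ℝ)) : ℂ) • T (bpt n M z j) (S₀ (bpt n M z j) v) := by
  simp [Az]

omit hM in
/-- `A_z − 1 = n^{−d} Σ_j (c·W(j)) • (T(x_j)∘S₀(x_j) − 1)`. [folklore] -/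
theorem Az_sub_one (T S₀ : Tor (fine n M) → (E →L[ℂ] E)) (z : Tor M) :
    Az n M T S₀ z - 1 = (((n : ℂ) ^ d)⁻¹ : ℂ) • ∑ j : Fin d → Fin n,
      (((((beta1 n) ^ d)⁻¹ * bumpW n j : ℝ)) : ℂ) • (T (bpt n M z j) * S₀ (bpt n M z j) - 1) := by
  have h1 : (1 : E →L[ℂ] E) = (((n : ℂ) ^ d)⁻¹ : ℂ) • ∑ j : Fin d → Fin n, (((((beta1 n) ^ d)⁻¹ * bumpW n j : ℝ)) : ℂ) • (1 : E →L[ℂ] E) := by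
    rw [← Finset.sum_smul, smul_smul, sum_weights_eq_one n, one_smul]
  conv_lhs => rw [h1]
  rw [Az, ← smul_sub, ← Finset.sum_sub_distrib]
  congr 1
  exact Finset.sum_congr rfl fun j _ => by rw [smul_sub]

omit hM in
/-- **`‖A_z − 1‖ ≤ γ`** when every relative transport satisfies `‖T(x)∘S₀(x) − 1‖ ≤ γ` (the weights are nonnegative with normalised sum `1`). [folklore] -/
theorem norm_Az_sub_one_le {T S₀ : Tor (fine n M) → (E →L[ℂ] E)} {γ : ℝ} (hrel : ∀ x, ‖T x * S₀ x - 1‖ ≤ γ) (z : Tor M) :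
    ‖Az n M T S₀ z - 1‖ ≤ γ := by
  obtain ⟨hc0, -⟩ := inv_beta_pow_mem n (d := d)
  have hn0 : (0 : ℝ) < (n : ℝ) ^ d := by have := NeZero.ne n; positivity
  have hw1 := weights_mean_one n (d := d)
  rw [Az_sub_one]
  calc ‖(((n : ℂ) ^ d)⁻¹ : ℂ) • ∑ j : Fin d → Fin n, (((((beta1 n) ^ d)⁻¹ * bumpW n j : ℝ)) : ℂ) • (T (bpt n M z j) * S₀ (bpt n M z j) - 1)‖
      ≤ ((n : ℝ) ^ d)⁻¹ * ∑ j : Fin d → Fin n, (((beta1 n) ^ d)⁻¹ * bumpW n j) * γ := by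
        rw [norm_smul, norm_inv, norm_pow, Complex.norm_natCast]
        refine mul_le_mul_of_nonneg_left ((norm_sum_le _ _).trans (sum_le_sum fun j _ => ?_)) (by positivity)
        rw [norm_smul, Complex.norm_real, Real.norm_of_nonneg (mul_nonneg hc0.le (bumpW_mem n j).1)]
        exact mul_le_mul_of_nonneg_left (hrel _) (mul_nonneg hc0.le (bumpW_mem n j).1)
    _ = γ := by rw [← Finset.sum_mul, ← mul_assoc, hw1, one_mul]

/-! ## §2 The inverse block operator (Neumann series; `E` complete) and the RELATIVE competitor -/

variable [CompleteSpace E]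

/-- the INVERSE BLOCK OPERATOR `B_z := Σ_k (1 − A_z)^k = A_z⁻¹` for `‖A_z − 1‖ ≤ γ < 1` (Neumann series, `Units.oneSub`). [folklore] -/
def Bz (T S₀ : Tor (fine n M) → (E →L[ℂ] E)) (z : Tor M) : E →L[ℂ] E := ∑' k : ℕ, (1 - Az n M T S₀ z) ^ k

omit hM in
/-- `A_z ∘ B_z = 1` and `‖B_z‖ ≤ (1 − γ)⁻¹` for `‖T∘S₀ − 1‖ ≤ γ < 1`. [folklore] -/
theorem Az_mul_Bz {T S₀ : Tor (fine n M) → (E →L[ℂ] E)} {γ : ℝ} (hγ : γ < 1) (hrel : ∀ x, ‖T x * S₀ x - 1‖ ≤ γ) (z : Tor M) :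
    Az n M T S₀ z * Bz n M T S₀ z = 1 ∧ ‖Bz n M T S₀ z‖ ≤ (1 - γ)⁻¹ := by
  have hlt : ‖1 - Az n M T S₀ z‖ < 1 := by
    rw [norm_sub_rev]; exact (norm_Az_sub_one_le n M hrel z).trans_lt hγ
  have hval : ((Units.oneSub _ hlt : (E →L[ℂ] E)ˣ) : E →L[ℂ] E) = Az n M T S₀ z := by simp
  have hinv : ((Units.oneSub _ hlt)⁻¹ : (E →L[ℂ] E)ˣ).val = Bz n M T S₀ z := rfl
  constructor
  · rw [← hval, ← hinv, Units.mul_inv]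
  · have h := tsum_geometric_le_of_norm_lt_one _ hlt
    have h1 : ‖(1 : E →L[ℂ] E)‖ ≤ 1 := ContinuousLinearMap.norm_id_le
    have h2 : (1 - ‖1 - Az n M T S₀ z‖)⁻¹ ≤ (1 - γ)⁻¹ := by
      refine inv_anti₀ (by linarith) ?_
      rw [norm_sub_rev]; linarith [norm_Az_sub_one_le n M hrel z]
    calc ‖Bz n M T S₀ z‖ = ‖∑' k : ℕ, (1 - Az n M T S₀ z) ^ k‖ := rfl
      _ ≤ ‖(1 : E →L[ℂ] E)‖ - 1 + (1 - ‖1 - Az n M T S₀ z‖)⁻¹ := h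
      _ ≤ (1 - γ)⁻¹ := by linarith

/-- **CONSTRAINT, EXACTLY, FOR THE ACTUAL TRANSPORTS**: the RELATIVE competitor `λ_φ := comp S₀ (z ↦ B_z (φ z))` (the reference right inverses `S₀`, the block
data PRE-ROTATED by `B_z = A_z⁻¹`) satisfies `Q_T λ_φ = φ` for the ACTUAL site transports `T` — `Q_T(comp S₀ φ′)(z) = A_z (φ′ z)`. [folklore] -/
theorem Qcv_comp_rel {T S₀ : Tor (fine n M) → (E →L[ℂ] E)} {γ : ℝ} (hγ : γ < 1) (hrel : ∀ x, ‖T x * S₀ x - 1‖ ≤ γ) (φ : Tor M → E) :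
    Qcv n M T (comp n M S₀ fun z => Bz n M T S₀ z (φ z)) = φ := by
  funext z
  have hA : Qcv n M T (comp n M S₀ fun z => Bz n M T S₀ z (φ z)) z = Az n M T S₀ z (Bz n M T S₀ z (φ z)) := by
    rw [Az_apply]
    simp only [Qcv, comp, trialv_bpt, map_smul, smul_smul]
    congr 1
    refine Finset.sum_congr rfl fun j _ => ?_
    push_cast
    ring_nf
  rw [hA, ← mul_apply_eq_comp, (Az_mul_Bz n M hγ hrel z).1, one_apply_eq_self]

/-! ## §3 The RELATIVE upper bound: actual transports `T` in the constraint, reference transports `(T₀, S₀)` in the energy -/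

/-- the pre-rotated block data are at most `(1 − γ)⁻¹` times larger: `Σ_z‖B_z(φ z)‖² ≤ (1 − γ)⁻²·Σ_z‖φ z‖²`. [folklore] -/
theorem nsqv_Bz_le {T S₀ : Tor (fine n M) → (E →L[ℂ] E)} {γ : ℝ} (hγ : γ < 1) (hrel : ∀ x, ‖T x * S₀ x - 1‖ ≤ γ) (φ : Tor M → E) :
    nsqv (fun z => Bz n M T S₀ z (φ z)) ≤ ((1 - γ)⁻¹) ^ 2 * nsqv φ := by
  unfold nsqv
  rw [Finset.mul_sum]
  refine Finset.sum_le_sum fun z _ => ?_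
  have hB := (Az_mul_Bz n M hγ hrel z).2
  have h1 : ‖Bz n M T S₀ z (φ z)‖ ≤ (1 - γ)⁻¹ * ‖φ z‖ := (ContinuousLinearMap.le_opNorm _ _).trans (mul_le_mul_of_nonneg_right hB (norm_nonneg _))
  have h0 : 0 ≤ (1 - γ)⁻¹ := inv_nonneg.mpr (by linarith)
  calc ‖Bz n M T S₀ z (φ z)‖ ^ 2 ≤ ((1 - γ)⁻¹ * ‖φ z‖) ^ 2 := pow_le_pow_left₀ (norm_nonneg _) h1 2
    _ = ((1 - γ)⁻¹) ^ 2 * ‖φ z‖ ^ 2 := by ring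

/-- **LEAF V-COL-UB RELATIVE TO A REFERENCE TRANSPORT (physical units)**: ACTUAL site transports `T` (arbitrary — e.g. nested composite contours) enter ONLY the
constraint; a REFERENCE pair `(T₀, S₀)` (`T₀∘S₀ = 1`, contractive — e.g. straight taxi contours) carries the in-block defect `w` of `(R, S₀, T₀)`; the two are tied by
the RELATIVE bound `‖T(x)∘S₀(x) − 1‖ ≤ γ < 1` (k-uniform small field).  Then the relative competitor meets `Q_T f = φ` EXACTLY and
`Sc(f) ≤ 2d·36^d·((1 + n w)² + 9)·(1 − γ)⁻²·Σ‖φ‖²` — the colour form of the road owner's repair (R1) «UB⁺ relative to a reference transport» (journal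
2026-08-20T09:59:27Z). [folklore] -/
theorem physDirv_comp_rel_le {T T₀ S₀ : Tor (fine n M) → (E →L[ℂ] E)} (hTS : ∀ x v, T₀ x (S₀ x v) = v) (hT : ∀ x, ‖T₀ x‖ ≤ 1)
    (hS : ∀ x, ‖S₀ x‖ ≤ 1) {R : Tor (fine n M) → Fin d → (E →L[ℂ] E)} (hR : ∀ x μ, ‖R x μ‖ ≤ 1) {w : ℝ} (hw0 : 0 ≤ w)
    (hw : ∀ (y : Tor M) (j : Fin d → Fin n) (μ : Fin d), (j μ : ℕ) + 1 < n →
      ‖R (bpt n M y j) μ * S₀ (bpt n M y j + unitVec (fine n M) μ) * T₀ (bpt n M y j) - 1‖ ≤ w)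
    {γ : ℝ} (hγ : γ < 1) (hrel : ∀ x, ‖T x * S₀ x - 1‖ ≤ γ) (φ : Tor M → E) :
    ((n : ℝ) ^ d)⁻¹ * ((n : ℝ) ^ 2 * ∑ μ, dirUv (fine n M) R (comp n M S₀ fun z => Bz n M T S₀ z (φ z)) μ)
      ≤ 2 * d * (36 : ℝ) ^ d * ((1 + n * w) ^ 2 + 9) / (1 - γ) ^ 2 * nsqv φ := by
  have h := physDirv_comp_le n M hTS hT hS hR hw0 hw (fun z => Bz n M T S₀ z (φ z))
  have hn : 0 ≤ n * w := by positivity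
  calc _ ≤ 2 * d * (36 : ℝ) ^ d * ((1 + n * w) ^ 2 + 9) * nsqv (fun z => Bz n M T S₀ z (φ z)) := h
    _ ≤ 2 * d * (36 : ℝ) ^ d * ((1 + n * w) ^ 2 + 9) * (((1 - γ)⁻¹) ^ 2 * nsqv φ) :=
        mul_le_mul_of_nonneg_left (nsqv_Bz_le n M hγ hrel φ) (by positivity)
    _ = _ := by rw [div_eq_mul_inv, inv_pow]; ring

/-- **LEAF V-COL-UB RELATIVE (block-spin reading)**: `Δ′_T(φ) := blockSpin (Qcv n M T) Sc φ ≤ 2d·36^d·((1 + n w)² + 9)·(1 − γ)⁻²·Σ‖φ‖²` for the ACTUAL transports `T`,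
with `w` the in-block defect of a contractive REFERENCE pair `(T₀, S₀)` and `‖T∘S₀ − 1‖ ≤ γ < 1` (`E` complete). [folklore] -/
theorem blockSpin_colour_le_rel {T T₀ S₀ : Tor (fine n M) → (E →L[ℂ] E)} (hTS : ∀ x v, T₀ x (S₀ x v) = v) (hT : ∀ x, ‖T₀ x‖ ≤ 1)
    (hS : ∀ x, ‖S₀ x‖ ≤ 1) {R : Tor (fine n M) → Fin d → (E →L[ℂ] E)} (hR : ∀ x μ, ‖R x μ‖ ≤ 1) {w : ℝ} (hw0 : 0 ≤ w)
    (hw : ∀ (y : Tor M) (j : Fin d → Fin n) (μ : Fin d), (j μ : ℕ) + 1 < n →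
      ‖R (bpt n M y j) μ * S₀ (bpt n M y j + unitVec (fine n M) μ) * T₀ (bpt n M y j) - 1‖ ≤ w)
    {γ : ℝ} (hγ : γ < 1) (hrel : ∀ x, ‖T x * S₀ x - 1‖ ≤ γ) (φ : Tor M → E) :
    blockSpin (Qcv n M T) (fun f => ((n : ℝ) ^ d)⁻¹ * ((n : ℝ) ^ 2 * ∑ μ, dirUv (fine n M) R f μ)) φ
      ≤ 2 * d * (36 : ℝ) ^ d * ((1 + n * w) ^ 2 + 9) / (1 - γ) ^ 2 * nsqv φ := by
  have hSn : ∀ f : Tor (fine n M) → E, 0 ≤ ((n : ℝ) ^ d)⁻¹ * ((n : ℝ) ^ 2 * ∑ μ, dirUv (fine n M) R f μ) := fun f => by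
    have : 0 ≤ ∑ μ, dirUv (fine n M) R f μ := sum_nonneg fun μ _ => dirUv_nonneg _ R f μ
    positivity
  exact (blockSpin_le hSn (Qcv_comp_rel n M hγ hrel φ)).trans (physDirv_comp_rel_le n M hTS hT hS hR hw0 hw hγ hrel φ)

/-- **`∃`-form, physical units**: `∃ f, Q_T f = φ ∧ Sc f ≤ 2d·36^d·((1 + n w)² + 9)·(1 − γ)⁻²·Σ‖φ‖²`. [folklore] -/
theorem exists_ubv_rel {T T₀ S₀ : Tor (fine n M) → (E →L[ℂ] E)} (hTS : ∀ x v, T₀ x (S₀ x v) = v) (hT : ∀ x, ‖T₀ x‖ ≤ 1)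
    (hS : ∀ x, ‖S₀ x‖ ≤ 1) {R : Tor (fine n M) → Fin d → (E →L[ℂ] E)} (hR : ∀ x μ, ‖R x μ‖ ≤ 1) {w : ℝ} (hw0 : 0 ≤ w)
    (hw : ∀ (y : Tor M) (j : Fin d → Fin n) (μ : Fin d), (j μ : ℕ) + 1 < n →
      ‖R (bpt n M y j) μ * S₀ (bpt n M y j + unitVec (fine n M) μ) * T₀ (bpt n M y j) - 1‖ ≤ w)
    {γ : ℝ} (hγ : γ < 1) (hrel : ∀ x, ‖T x * S₀ x - 1‖ ≤ γ) :
    ∀ φ : Tor M → E, ∃ f : Tor (fine n M) → E, Qcv n M T f = φ ∧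
      ((n : ℝ) ^ d)⁻¹ * ((n : ℝ) ^ 2 * ∑ μ, dirUv (fine n M) R f μ) ≤ 2 * d * (36 : ℝ) ^ d * ((1 + n * w) ^ 2 + 9) / (1 - γ) ^ 2 * nsqv φ :=
  fun φ => ⟨_, Qcv_comp_rel n M hγ hrel φ, physDirv_comp_rel_le n M hTS hT hS hR hw0 hw hγ hrel φ⟩

/-! ## §4 The SAME SHAPE at a fictitious defect `w_eff` with `(4 + n·w)/(1 − γ) − 1 ≤ n·w_eff` (the road owner's `lamC_rel_le`, BY NAME) -/

/-- **`∃`-form IN THE EXACT SHAPE OF `exists_ubv_phys` AT THE FICTITIOUS DEFECT `w_eff`** (`(4 + n·w)/(1−γ) − 1 ≤ n·w_eff`): the relative bound re-packed so that a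
consumer written for the absolute leaf (binder `Λ(n·w)·Σ‖φ‖²`) takes it unchanged — the road owner's (R1) bookkeeping «CLASS preserved:
`n·w_eff ≤ (4 + c_w)/(1 − γ) − 1`», his `lamC_rel_le` consumed BY NAME (colour twin of `exists_ub_scalarPair_rel_eff`). [folklore] -/
theorem exists_ubv_rel_eff {T T₀ S₀ : Tor (fine n M) → (E →L[ℂ] E)} (hTS : ∀ x v, T₀ x (S₀ x v) = v) (hT : ∀ x, ‖T₀ x‖ ≤ 1)
    (hS : ∀ x, ‖S₀ x‖ ≤ 1) {R : Tor (fine n M) → Fin d → (E →L[ℂ] E)} (hR : ∀ x μ, ‖R x μ‖ ≤ 1) {w : ℝ} (hw0 : 0 ≤ w)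
    (hw : ∀ (y : Tor M) (j : Fin d → Fin n) (μ : Fin d), (j μ : ℕ) + 1 < n →
      ‖R (bpt n M y j) μ * S₀ (bpt n M y j + unitVec (fine n M) μ) * T₀ (bpt n M y j) - 1‖ ≤ w)
    {γ : ℝ} (hγ : γ < 1) (hrel : ∀ x, ‖T x * S₀ x - 1‖ ≤ γ) {w' : ℝ} (hw' : (4 + n * w) / (1 - γ) - 1 ≤ n * w') :
    ∀ φ : Tor M → E, ∃ f : Tor (fine n M) → E, Qcv n M T f = φ ∧
      ((n : ℝ) ^ d)⁻¹ * ((n : ℝ) ^ 2 * ∑ μ, dirUv (fine n M) R f μ) ≤ 2 * d * (36 : ℝ) ^ d * ((1 + n * w') ^ 2 + 9) * nsqv φ := by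
  intro φ
  obtain ⟨f, hf, hb⟩ := exists_ubv_rel n M hTS hT hS hR hw0 hw hγ hrel φ
  refine ⟨f, hf, hb.trans ?_⟩
  have hx : 0 ≤ (n : ℝ) * w := by positivity
  have h := lamC_rel_le hx hγ hw'
  have hφ := nsqv_nonneg φ
  have hd : (0 : ℝ) ≤ 2 * d * (36 : ℝ) ^ d := by positivity
  calc 2 * d * (36 : ℝ) ^ d * ((1 + n * w) ^ 2 + 9) / (1 - γ) ^ 2 * nsqv φ
      = 2 * d * (36 : ℝ) ^ d * (((1 + n * w) ^ 2 + 9) / (1 - γ) ^ 2) * nsqv φ := by ring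
    _ ≤ 2 * d * (36 : ℝ) ^ d * ((1 + n * w') ^ 2 + 9) * nsqv φ := by gcongr

end Summit.QuantumFields.BalabanUV.T4Continuum.VariationalColourUpperBound

end
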